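import Mathlib
import HarnessLib

/-!
# Venture HSemireg — the exterior EXCLUSION criterion of the full fibre test
(«cyclic triangles carry no exterior 3-plane»)

HONEST FRAMING. Lean leaf for the computation cell `pub-hsemireg` (target seat t-5 gen 12; file of
record `run/shared/lean/pub/pub-hsemireg/target-g6/GRID-BARRIER-t5g9.md` §16.1–16.2, 2026-08-23;
the pencil argument is red-3 g37's FINDING R3-G37-1, logic half ×2 by th-3 g24). In the
Hochschild–Koszul model the Yoneda algebra `Ext^•(F,F)` of a 0-dimensional COMPLEX `F` is an
associative, not graded-commutative, algebra `A`; the Fibre Lemma's test (F3) asks for a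
3-plane `K` inside a given subspace `W = span(w_p)` that is EXTERIOR — every `k ∈ K` has
`k² = 0` (so `K` anticommutes pairwise) — and whose triple products `k₁k₂k₃` reach the volume
class. The machine finds, for every «weak pass», that (m1) the symmetrised products
`w_p w_q + w_q w_p` of certain basis pairs `E` («non-anticommuting pairs») can be EXTRACTED from any
symmetric quadratic relation among the `w_p w_q` (they are linearly independent of all the other
products), and (m2) every basis triple with `w_p w_q w_r ≠ 0` contains such a pair. THIS FILE
kernel-checks the LOGIC that turns (m1)+(m2) into a verdict: if every element of
`K = span(k_1, …, k_m)`, `k_j = Σ_p κ_{jp} w_p`, squares to zero, then (m1) forces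
`κ_{·p} = 0` or `κ_{·q} = 0` on `K` for each pair in `E` (a product of two non-zero linear forms
is not identically zero — here in the elementary form «`κ_{ip} κ_{iq} = 0` and
`(κ_{ip}+κ_{i'p})(κ_{iq}+κ_{i'q}) = 0` for all `i, i'`»), and then (m2) kills every monomial of
every triple product: `k_{j₁} k_{j₂} k_{j₃} = 0` — NO exterior subspace of `W` carries a non-zero
triple product, in particular none reaches `vol ≠ 0`, and the full test FAILS
(`triple_product_eq_zero_of_sq_eq_zero`). Only this algebra is formalised; the machine facts
(m1), (m2) for the 130 re-scored objects, the HK model and everything else in §12–§16 of the note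
are NOT. No object is constructed; nothing here bears on HC, HC_CM or HC_AV.
-/

namespace Summit.Ventures.HSemireg

open Finset

variable {F : Type*} [Field F] {A : Type*} [Ring A] [Algebra F A]
variable {ι : Type*} [Fintype ι] {m : ℕ}

/-- Expansion of a product of two linear combinations. [folklore] -/
theorem sum_smul_mul_sum_smul (a b : ι → F) (w v : ι → A) :
    (∑ p, a p • w p) * (∑ q, b q • v q) = ∑ p, ∑ q, (a p * b q) • (w p * v q) := by
  rw [Finset.sum_mul_sum]
  refine Finset.sum_congr rfl fun p _ => Finset.sum_congr rfl fun q _ => ?_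
  rw [smul_mul_assoc, mul_smul_comm, smul_smul]

/-- Expansion of a product of three linear combinations. [folklore] -/
theorem sum_smul_mul_sum_smul_mul_sum_smul (a b c : ι → F) (w : ι → A) :
    (∑ p, a p • w p) * (∑ q, b q • w q) * (∑ r, c r • w r) =
      ∑ p, ∑ q, ∑ r, (a p * b q * c r) • (w p * w q * w r) := by
  rw [sum_smul_mul_sum_smul, Finset.sum_mul]
  refine Finset.sum_congr rfl fun p _ => ?_
  rw [Finset.sum_mul]
  refine Finset.sum_congr rfl fun q _ => ?_
  rw [Finset.mul_sum]
  refine Finset.sum_congr rfl fun r _ => ?_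
  rw [smul_mul_assoc, mul_smul_comm, smul_smul]

/-- The coordinates of a linear combination `Σ_j t_j k_j` of the generators
`k_j = Σ_p κ_{jp} w_p` in terms of the `w_p`. [folklore] -/
theorem sum_smul_generators_eq (κ : Fin m → ι → F) (w : ι → A) (t : Fin m → F) :
    ∑ j, t j • ∑ p, κ j p • w p = ∑ p, (∑ j, t j * κ j p) • w p := by
  simp_rw [Finset.smul_sum, smul_smul]
  rw [Finset.sum_comm]
  refine Finset.sum_congr rfl fun p _ => ?_
  rw [Finset.sum_smul]

/-- **Step 1 (coefficient extraction ⇒ vanishing products of coordinates).** If every element of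
`K = span(k_j)` squares to zero and the symmetrised products of the pairs in `E` can be extracted
from any symmetric quadratic relation among the `w_p w_q` (hypothesis `hE`, the machine fact
(m1)), then for every pair `(p,q) ∈ E` and every coefficient vector `t` the `p`-th and `q`-th
coordinates of `Σ t_j k_j` have product zero. [folklore] -/
theorem coord_mul_coord_eq_zero (w : ι → A) (E : ι → ι → Prop)
    (hE : ∀ c : ι → ι → F, (∀ p q, c p q = c q p) →
      ∑ p, ∑ q, c p q • (w p * w q) = 0 → ∀ p q, E p q → c p q = 0)
    (κ : Fin m → ι → F)
    (hsq : ∀ t : Fin m → F,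
      (∑ j, t j • ∑ p, κ j p • w p) * (∑ j, t j • ∑ p, κ j p • w p) = 0)
    (t : Fin m → F) {p q : ι} (hpq : E p q) :
    (∑ j, t j * κ j p) * (∑ j, t j * κ j q) = 0 := by
  have h := hsq t
  rw [sum_smul_generators_eq, sum_smul_mul_sum_smul] at h
  exact hE (fun p q => (∑ j, t j * κ j p) * (∑ j, t j * κ j q)) (fun p q => mul_comm _ _) h p q hpq

/-- **Step 2 (one of the two coordinate forms vanishes identically).** Under the same hypotheses,
for each pair `(p,q) ∈ E` either ALL generators have zero `p`-coordinate or ALL have zero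
`q`-coordinate — «a product of two non-zero linear forms on `K` is not identically zero», in the
elementary form using only the coefficient vectors `e_i` and `e_i + e_{i'}`. [folklore] -/
theorem coord_eq_zero_or_coord_eq_zero (w : ι → A) (E : ι → ι → Prop)
    (hE : ∀ c : ι → ι → F, (∀ p q, c p q = c q p) →
      ∑ p, ∑ q, c p q • (w p * w q) = 0 → ∀ p q, E p q → c p q = 0)
    (κ : Fin m → ι → F)
    (hsq : ∀ t : Fin m → F,
      (∑ j, t j • ∑ p, κ j p • w p) * (∑ j, t j • ∑ p, κ j p • w p) = 0)
    {p q : ι} (hpq : E p q) :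
    (∀ j, κ j p = 0) ∨ (∀ j, κ j q = 0) := by
  -- single generators: κ_{ip} κ_{iq} = 0
  have h1 : ∀ i, κ i p * κ i q = 0 := by
    intro i
    have := coord_mul_coord_eq_zero w E hE κ hsq (fun j => if j = i then 1 else 0) hpq
    simpa [Finset.sum_ite_eq', ite_mul, one_mul, zero_mul] using this
  -- pairs of generators: (κ_{ip} + κ_{i'p}) (κ_{iq} + κ_{i'q}) = 0
  have h2 : ∀ i i', i ≠ i' → (κ i p + κ i' p) * (κ i q + κ i' q) = 0 := by
    intro i i' hii'
    have := coord_mul_coord_eq_zero w E hE κ hsq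
      (fun j => (if j = i then 1 else 0) + (if j = i' then 1 else 0)) hpq
    have hsum : ∀ r : ι, ∑ j, ((if j = i then (1 : F) else 0) + (if j = i' then 1 else 0)) * κ j r
        = κ i r + κ i' r := by
      intro r
      simp_rw [add_mul, Finset.sum_add_distrib, ite_mul, one_mul, zero_mul, Finset.sum_ite_eq',
        Finset.mem_univ, if_true]
    rwa [hsum p, hsum q] at this
  by_contra hcon
  rw [not_or, not_forall, not_forall] at hcon
  obtain ⟨⟨i, hi⟩, ⟨i', hi'⟩⟩ := hcon
  have hiq : κ i q = 0 := by
    rcases mul_eq_zero.mp (h1 i) with h | h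
    · exact absurd h hi
    · exact h
  have hi'p : κ i' p = 0 := by
    rcases mul_eq_zero.mp (h1 i') with h | h
    · exact h
    · exact absurd h hi'
  by_cases hii' : i = i'
  · subst hii'
    exact hi hi'p
  · have := h2 i i' hii'
    rw [hi'p, hiq, add_zero, zero_add] at this
    rcases mul_eq_zero.mp this with h | h
    · exact hi h
    · exact hi' h

/-- **THE EXCLUSION CRITERION (GRID-BARRIER §16.1–16.2).** Let `w_p ∈ A` (`p ∈ ι`) and let `E`
be a set of pairs such that (m1) their symmetrised products can be extracted from every symmetric
quadratic relation `Σ c_{pq} w_p w_q = 0` (hypothesis `hE`) and (m2) every triple with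
`w_p w_q w_r ≠ 0` contains a pair of `E` (hypothesis `hT`). If every element of
`K = span(k_1,…,k_m)`, `k_j = Σ κ_{jp} w_p`, squares to zero (`K` is EXTERIOR), then ALL triple
products of the generators vanish: `k_{j₁} k_{j₂} k_{j₃} = 0`. In the fibre test this means
`Λ³K → Ext³` is zero, so no exterior `K ⊂ W` reaches `vol ≠ 0`: the full (F3) FAILS — the verdict
logic behind the 130 certified re-scorings of §16.2. [folklore] -/
theorem triple_product_eq_zero_of_sq_eq_zero (w : ι → A) (E : ι → ι → Prop)
    (hE : ∀ c : ι → ι → F, (∀ p q, c p q = c q p) →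
      ∑ p, ∑ q, c p q • (w p * w q) = 0 → ∀ p q, E p q → c p q = 0)
    (hT : ∀ p q r, E p q ∨ E p r ∨ E q r ∨ w p * w q * w r = 0)
    (κ : Fin m → ι → F)
    (hsq : ∀ t : Fin m → F,
      (∑ j, t j • ∑ p, κ j p • w p) * (∑ j, t j • ∑ p, κ j p • w p) = 0)
    (j₁ j₂ j₃ : Fin m) :
    (∑ p, κ j₁ p • w p) * (∑ p, κ j₂ p • w p) * (∑ p, κ j₃ p • w p) = 0 := by
  rw [sum_smul_mul_sum_smul_mul_sum_smul]
  refine Finset.sum_eq_zero fun p _ => Finset.sum_eq_zero fun q _ =>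
    Finset.sum_eq_zero fun r _ => ?_
  have hz := fun {p q : ι} (h : E p q) => coord_eq_zero_or_coord_eq_zero w E hE κ hsq h
  rcases hT p q r with h | h | h | h
  · rcases hz h with h0 | h0
    · rw [h0 j₁, zero_mul, zero_mul, zero_smul]
    · rw [h0 j₂, mul_zero, zero_mul, zero_smul]
  · rcases hz h with h0 | h0
    · rw [h0 j₁, zero_mul, zero_mul, zero_smul]
    · rw [h0 j₃, mul_zero, zero_smul]
  · rcases hz h with h0 | h0
    · rw [h0 j₂, mul_zero, zero_mul, zero_smul]
    · rw [h0 j₃, mul_zero, zero_smul]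
  · rw [h, smul_zero]

/-- **Corollary (no exterior certificate reaches a non-zero class).** Under (m1), (m2), no three
elements of an exterior `K = span(k_j)` have product equal to `c • v` with `c ≠ 0` and `v ≠ 0`
(e.g. `v = vol`, non-zero whenever `χ(F) ≠ 0` — Lean leaf `FibreTestTraceAnchor`). [folklore] -/
theorem no_exterior_certificate (w : ι → A) (E : ι → ι → Prop)
    (hE : ∀ c : ι → ι → F, (∀ p q, c p q = c q p) →
      ∑ p, ∑ q, c p q • (w p * w q) = 0 → ∀ p q, E p q → c p q = 0)
    (hT : ∀ p q r, E p q ∨ E p r ∨ E q r ∨ w p * w q * w r = 0)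
    (κ : Fin m → ι → F)
    (hsq : ∀ t : Fin m → F,
      (∑ j, t j • ∑ p, κ j p • w p) * (∑ j, t j • ∑ p, κ j p • w p) = 0)
    {v : A} (hv : v ≠ 0) {c : F} (hc : c ≠ 0) (j₁ j₂ j₃ : Fin m) :
    (∑ p, κ j₁ p • w p) * (∑ p, κ j₂ p • w p) * (∑ p, κ j₃ p • w p) ≠ c • v := by
  rw [triple_product_eq_zero_of_sq_eq_zero w E hE hT κ hsq]
  intro h
  exact hv ((smul_eq_zero.mp h.symm).resolve_left hc)

end Summit.Ventures.HSemireg
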